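import Literature.Computability.QuantumComplexity.ExactHalfQueryAlgorithmCore
import HarnessLib

/-!
# The exact `(k+1)`-query algorithm for `MAJ_{2k+1}` (Ambainis–Iraids–Smotrovs 2013, Thm. 2) — core:
# marked histories, amplitudes, majority preservation, the round family and its admissibility

Topic `Computability/QuantumComplexity`. A. Ambainis, J. Iraids, J. Smotrovs, *Exact quantum query
complexity of EXACT and THRESHOLD*, TQC 2013 [AmbainisIraidsSmotrovs2013], §4, Theorem 2 and its proof
(held text `paper:arxiv-1302.1235`, p. 6 L1–45):

> **Definition 2.** The function `Th_k^n` is […] true iff at least `k` of the variables are equal to `1`.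
> The function `Th_{k+1}^{2k+1}` is commonly referred to as `MAJ_{2k+1}` […].
> **Theorem 2.** `Q_E(MAJ_{2k+1}) ≤ k + 1`.
> *Proof.* Again, a recursive solution is constructed as follows. The base case `k = 0` is trivial to
> perform with one query, because the function returns the value of the single variable. The recursive
> step `k = m` shares the states, unitary transformation `U_1` and the query with our algorithm for
> `EXACT`, but the unitary `U_2` is slightly different: `U_1|0⟩ → Σ_{i=1}^{2m+1} (1/√(2m+1)) |i⟩`, […]
> `U_2|i⟩ = Σ_{j>i} (√(2m−1)/2m) |i,j⟩ − Σ_{j<i} (√(2m−1)/2m) |j,i⟩ + Σ_{j≠i} (1/2m) |j⟩`. The resulting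
> state is `Σ_i Σ_{j≠i} (x̂_j/(2m√(2m+1))) |i⟩ + Σ_{i<j} ((x̂_i − x̂_j)√(2m−1)/(2m√(2m+1))) |i,j⟩`. We
> perform a complete measurement. There are two kinds of outcomes: If we get state `|i⟩`, then either
> `x_i` is the value in the majority which according to the polynomial `Σ_{j≠i} x̂_j` not being zero
> implies that in `x ∖ {x_i}` the number of ones is greater than the number of zeroes by at least 2; or
> `x_i` is a value in the minority. In both of these cases, for all `j : j ≠ i` it is true that
> `MAJ_{2m+1}(x) = MAJ_{2m−1}(x ∖ {x_i, x_j})`. Therefore, we can solve both cases by removing `x_i` and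
> one other arbitrary input value and calculating majority from the remaining values. If we get state
> `|i,j⟩`, then it is even better: we know that `x_i ≠ x_j` and therefore
> `MAJ_{2m+1}(x) = MAJ_{2m−1}(x ∖ {x_i, x_j})`. □

This file and `MajorityQueryAlgorithm.lean` type that proof as ONE straight-line program in the tree's query
model `QQueryAlg (2k+1)` ([BealsEtAl2001, §2]), with deferred measurements as for Theorem 1
(`ExactHalfQueryAlgorithmCore.lean`). The workspace `WS k = Hist k` records, for every index, the round that
removed it and a mark "was the measured single `|i⟩`" (`Fin k × Bool`). The printed proof and its image:

* the call's basis states `|1⟩, …, |2m+1⟩` ↦ the live states `|l, b, g⟩`, `l` free in `g` (`Dset`); the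
  outcome `|i,j⟩`, "a starting state for the recursive call", ↦ the next call's prepared state on the
  history `g·(i:pair, j)` (`addTwo g r i false j`); the outcome `|i⟩` followed by "removing `x_i` and one
  other arbitrary input value `x_j`" ↦ the prepared state on `g·(i:single, j)` (`addTwo g r i true j`), the
  arbitrary partner `j` being chosen COHERENTLY AND UNIFORMLY among the `2m` others (weight `1/√(2m)`;
  every choice is correct by the printed argument, so exactness is unaffected — this is the one deviation
  from the letter of the text, forced by typing "arbitrary" inside a unitary);
* `U_2` ↦ the round family `w(|i,b,h⟩) = aP · Σ_{j≠i} sign(i,j) ψ_{h·(i:pair,j),b} + aS · Σ_{j≠i} Σ_{p≠j}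
  ψ_{h·(j:single,p),b}` with `aP = √(2m−1)/(2m)` and `aS = (1/(2m))·(1/√(2m))` (`pairPart`, `singlePart`,
  `wR` / `wvec`); its Gram matrix is computed in `pairPart_dot` (`2m` / `−1`), `singlePart_dot`
  (`2m·2m` / `2m(2m−1)`), `pairPart_dot_singlePart` (`0`), giving unit norm `(2m−1)/(2m) + 1/(2m) = 1`
  (`wR_dot_self`) and orthogonality `−(2m−1)/(4m²) + (2m−1)/(4m²) = 0` (`wR_dot_of_ne_index`), packaged as
  `wvec_isAdmissible` for `IsoGate.invoGate` (the paper does not print this check for `U_2` of Thm. 2);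
* "the resulting state" ↦ the amplitude `beta` of a marked history with the round factor `roundAmp` =
  the pair term `aP · sign(a,b)(x̂_a − x̂_b)` (`roundAmp_pair`) or the single term `aS · Σ_{l≠a} x̂_l`
  (`roundAmp_single`), and the re-indexing of the branching `sum_validSet_reindex`;
* the case analysis "`x_i` in the majority … by at least 2; or `x_i` in the minority; … `x_i ≠ x_j`" ↦
  `diff_pos_iff_of_roundAmp_ne_zero` (one round preserves the sign of `#ones − #zeros` on a surviving
  branch), `diff_pos_iff_of_beta_ne_zero` (along a surviving history) and `eq_maj_of_beta_ne_zero` (the base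
  case: the last free variable carries the majority value).

The program (`U_1`, `k` rounds, a fixed rotation of the `|−⟩` target to `|0⟩`, one classical query reading the
last variable: `k + 1` queries), the invariant and Theorem 2 itself (`Q_E(MAJ_{2k+1}) = k + 1`, floor [AIS13,
Prop. 3] = `ExactThreshold.le_quantumQueryComplexity_zero_threshold`) are in `MajorityQueryAlgorithm.lean`.
Everything here is proved; no instance, notation or axiom is introduced.

* [AmbainisIraidsSmotrovs2013] A. Ambainis, J. Iraids, J. Smotrovs, *Exact quantum query complexity of
  EXACT and THRESHOLD*, Proc. TQC 2013 (LIPIcs 22) 263–269; arXiv:1302.1235 — §4, Def. 2, Thm. 2 and its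
  proof (p. 6 L1–45).
* [BealsEtAl2001] R. Beals, H. Buhrman, R. Cleve, M. Mosca, R. de Wolf, *Quantum lower bounds by
  polynomials*, J. ACM 48(4) (2001) 778–797 — §2 (the query model, phase queries).
-/

noncomputable section

open Finset
open Literature.Computability.QuantumComplexity.ExactHalf (sum_offDiag_eq_sum_erase)

namespace Literature.Computability.QuantumComplexity.Majority

variable {k : ℕ}

/-! ### Marked histories -/

/-- A marked history on `2k+1` indices: for each index, the round (`< k`) that removed it and whether it
was that round's measured single `|i⟩` (`true`) or a pair member / the single's partner (`false`).
[cite: AmbainisIraidsSmotrovs2013, §4 (proof of Thm. 2: outcomes `|i⟩` and `|i,j⟩`)] -/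
abbrev Hist (k : ℕ) := Fin (2 * k + 1) → Option (Fin k × Bool)

/-- The indices removed in round `r`. [cite: AmbainisIraidsSmotrovs2013, §4] -/
def labelSet (h : Hist k) (r : Fin k) : Finset (Fin (2 * k + 1)) :=
  univ.filter fun i => (h i).map Prod.fst = some r

/-- The measured singles of round `r` (at most one in a valid history). [cite: AmbainisIraidsSmotrovs2013, §4] -/
def singles (h : Hist k) (r : Fin k) : Finset (Fin (2 * k + 1)) := univ.filter fun i => h i = some (r, true)

/-- The indices still active. [cite: AmbainisIraidsSmotrovs2013, §4] -/
def free (h : Hist k) : Finset (Fin (2 * k + 1)) := univ.filter fun i => h i = none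

/-- A valid history after `t` rounds: only rounds `< t` occur, each removed exactly two indices, at most
one of them a measured single. [cite: AmbainisIraidsSmotrovs2013, §4] -/
def Valid (t : ℕ) (h : Hist k) : Prop :=
  (∀ i r b, h i = some (r, b) → r.val < t) ∧
    (∀ r : Fin k, r.val < t → (labelSet h r).card = 2 ∧ (singles h r).card ≤ 1)

/-- The empty history. [cite: AmbainisIraidsSmotrovs2013, §4] -/
def emptyHist (k : ℕ) : Hist k := fun _ => none

/-- Removing `i` (with mark `bi`) and `j` (unmarked) in round `r`: `bi = false` is the outcome `|i,j⟩`,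
`bi = true` the outcome `|i⟩` with partner `j`. [cite: AmbainisIraidsSmotrovs2013, §4] -/
def addTwo (h : Hist k) (r : Fin k) (i : Fin (2 * k + 1)) (bi : Bool) (j : Fin (2 * k + 1)) : Hist k :=
  fun l => if l = i then some (r, bi) else if l = j then some (r, false) else h l

/-- Undoing round `r`. [cite: AmbainisIraidsSmotrovs2013, §4] -/
def eraseRound (h : Hist k) (r : Fin k) : Hist k :=
  fun l => if (h l).map Prod.fst = some r then none else h l

/-- Round labels through `Option.map`. [cite: AmbainisIraidsSmotrovs2013, §4] -/
theorem map_fst_eq_some_iff {o : Option (Fin k × Bool)} {r : Fin k} :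
    o.map Prod.fst = some r ↔ ∃ b, o = some (r, b) := by
  cases o with
  | none => simp
  | some p => obtain ⟨r', b⟩ := p; constructor <;> intro h <;> simp_all

/-- Membership in a label class. [cite: AmbainisIraidsSmotrovs2013, §4] -/
@[simp] theorem mem_labelSet {h : Hist k} {r : Fin k} {i : Fin (2 * k + 1)} :
    i ∈ labelSet h r ↔ ∃ b, h i = some (r, b) := by
  simp only [labelSet, mem_filter, mem_univ, true_and, map_fst_eq_some_iff]

/-- Membership in the singles. [cite: AmbainisIraidsSmotrovs2013, §4] -/
@[simp] theorem mem_singles {h : Hist k} {r : Fin k} {i : Fin (2 * k + 1)} :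
    i ∈ singles h r ↔ h i = some (r, true) := by
  simp [singles]

/-- Membership in the free set. [cite: AmbainisIraidsSmotrovs2013, §4] -/
@[simp] theorem mem_free {h : Hist k} {i : Fin (2 * k + 1)} : i ∈ free h ↔ h i = none := by
  simp [free]

/-- The empty history is the valid `0`-history. [cite: AmbainisIraidsSmotrovs2013, §4] -/
theorem valid_emptyHist : Valid 0 (emptyHist k) :=
  ⟨fun i r b h => by simp [emptyHist] at h, fun r hr => absurd hr (Nat.not_lt_zero _)⟩

/-- Everything is free at the start (`2k+1` active variables). [cite: AmbainisIraidsSmotrovs2013, §4] -/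
theorem free_emptyHist : free (emptyHist k) = univ := by
  ext i; simp [emptyHist]

/-- The label classes and the free set partition the indices: `#free + 2t = 2k + 1`.
[cite: AmbainisIraidsSmotrovs2013, §4 (proof of Thm. 2)] -/
theorem card_free_add (t : ℕ) {h : Hist k} (hv : Valid t h) (ht : t ≤ k) :
    (free h).card + 2 * t = 2 * k + 1 := by
  classical
  have hcover : (univ : Finset (Fin (2 * k + 1))) =
      free h ∪ (univ.filter fun r : Fin k => r.val < t).biUnion (labelSet h) := by
    ext i
    simp only [mem_univ, mem_union, mem_free, mem_biUnion, mem_filter, mem_labelSet, true_and, true_iff]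
    cases hi : h i with
    | none => exact Or.inl rfl
    | some p => obtain ⟨r, b⟩ := p; exact Or.inr ⟨r, hv.1 i r b hi, b, rfl⟩
  have hdisj : Disjoint (free h) ((univ.filter fun r : Fin k => r.val < t).biUnion (labelSet h)) := by
    rw [Finset.disjoint_left]
    intro i hi hi'
    rw [mem_free] at hi
    obtain ⟨r, -, hr⟩ := mem_biUnion.1 hi'
    obtain ⟨b, hb⟩ := mem_labelSet.1 hr
    rw [hi] at hb; exact absurd hb (by simp)
  have hpd : ((univ.filter fun r : Fin k => r.val < t) : Set (Fin k)).PairwiseDisjoint (labelSet h) := by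
    intro r _ r' _ hrr'
    rw [Function.onFun, Finset.disjoint_left]
    intro i hi hi'
    obtain ⟨b, hb⟩ := mem_labelSet.1 hi
    obtain ⟨b', hb'⟩ := mem_labelSet.1 hi'
    rw [hb] at hb'
    exact hrr' (by cases hb'; rfl)
  have hpair : ∑ r ∈ univ.filter (fun r : Fin k => r.val < t), (labelSet h r).card = 2 * t := by
    rw [Finset.sum_congr rfl fun r hr => (hv.2 r (mem_filter.1 hr).2).1, sum_const, smul_eq_mul,
      Fin.card_filter_val_lt, Nat.min_eq_right ht, mul_comm]
  have := congrArg Finset.card hcover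
  rw [Finset.card_union_of_disjoint hdisj, Finset.card_univ, Fintype.card_fin, Finset.card_biUnion hpd,
    hpair] at this
  omega

/-! ### Adding and erasing a round -/

variable {h : Hist k} {t : ℕ}

/-- The first removed index carries `(r, bi)`. [cite: AmbainisIraidsSmotrovs2013, §4] -/
theorem addTwo_apply_left (h : Hist k) (r : Fin k) (i : Fin (2 * k + 1)) (bi : Bool) (j : Fin (2 * k + 1)) :
    addTwo h r i bi j i = some (r, bi) := by
  simp [addTwo]

/-- The second removed index carries `(r, false)` (`i ≠ j`). [cite: AmbainisIraidsSmotrovs2013, §4] -/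
theorem addTwo_apply_right (h : Hist k) (r : Fin k) {i j : Fin (2 * k + 1)} (bi : Bool) (hij : i ≠ j) :
    addTwo h r i bi j j = some (r, false) := by
  simp [addTwo, hij.symm]

/-- Other indices keep their labels. [cite: AmbainisIraidsSmotrovs2013, §4] -/
theorem addTwo_apply_of_ne {r : Fin k} {i j l : Fin (2 * k + 1)} {bi : Bool} (hi : l ≠ i) (hj : l ≠ j) :
    addTwo h r i bi j l = h l := by
  simp [addTwo, hi, hj]

/-- In a valid `t`-history no index carries a round label `≥ t`. [cite: AmbainisIraidsSmotrovs2013, §4] -/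
theorem ne_some_of_valid (hv : Valid t h) {r : Fin k} (hr : t ≤ r.val) (l : Fin (2 * k + 1)) (b : Bool) :
    h l ≠ some (r, b) :=
  fun hl => absurd (hv.1 l r b hl) (by omega)

/-- Same, through the round projection. [cite: AmbainisIraidsSmotrovs2013, §4] -/
theorem map_fst_ne_of_valid (hv : Valid t h) {r : Fin k} (hr : t ≤ r.val) (l : Fin (2 * k + 1)) :
    (h l).map Prod.fst ≠ some r := fun hl => by
  obtain ⟨b, hb⟩ := map_fst_eq_some_iff.1 hl
  exact ne_some_of_valid hv hr l b hb

/-- The free set after a round. [cite: AmbainisIraidsSmotrovs2013, §4] -/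
theorem free_addTwo (h : Hist k) (r : Fin k) (i : Fin (2 * k + 1)) (bi : Bool) (j : Fin (2 * k + 1)) :
    free (addTwo h r i bi j) = ((free h).erase i).erase j := by
  ext l
  simp only [mem_free, Finset.mem_erase, addTwo]
  by_cases hli : l = i
  · subst hli; simp
  · by_cases hlj : l = j
    · subst hlj; simp [hli]
    · simp [hli, hlj]

/-- The round-`r` class of the extended history is `{i, j}`. [cite: AmbainisIraidsSmotrovs2013, §4] -/
theorem labelSet_addTwo_self (hv : Valid t h) {r : Fin k} (hr : t ≤ r.val) (i : Fin (2 * k + 1)) (bi : Bool)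
    (j : Fin (2 * k + 1)) : labelSet (addTwo h r i bi j) r = {i, j} := by
  ext l
  simp only [mem_labelSet, addTwo, Finset.mem_insert, Finset.mem_singleton]
  constructor
  · rintro ⟨b, hl⟩
    by_contra hne
    push Not at hne
    rw [if_neg hne.1, if_neg hne.2] at hl
    exact ne_some_of_valid hv hr l b hl
  · intro hl
    rcases hl with rfl | rfl
    · exact ⟨bi, by simp⟩
    · by_cases hji : l = i
      · exact ⟨bi, by simp [hji]⟩
      · exact ⟨false, by simp [hji]⟩

/-- The singles of the extended history in round `r`. [cite: AmbainisIraidsSmotrovs2013, §4] -/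
theorem singles_addTwo_self (hv : Valid t h) {r : Fin k} (hr : t ≤ r.val) (i : Fin (2 * k + 1)) (bi : Bool)
    (j : Fin (2 * k + 1)) : singles (addTwo h r i bi j) r = if bi = true then {i} else ∅ := by
  ext l
  simp only [mem_singles, addTwo]
  by_cases hli : l = i
  · subst hli; cases bi <;> simp
  · rw [if_neg hli]
    by_cases hlj : l = j
    · rw [if_pos hlj]; cases bi <;> simp [hli]
    · rw [if_neg hlj]; cases bi <;> simp [hli, ne_some_of_valid hv hr l true]

/-- Earlier label classes are unchanged by a new round. [cite: AmbainisIraidsSmotrovs2013, §4] -/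
theorem labelSet_addTwo_of_ne {r r' : Fin k} (hrr : r' ≠ r) {i j : Fin (2 * k + 1)} {bi : Bool}
    (hi : h i = none) (hj : h j = none) : labelSet (addTwo h r i bi j) r' = labelSet h r' := by
  ext l
  simp only [mem_labelSet, addTwo]
  by_cases hli : l = i
  · subst hli; simp [hi, hrr.symm]
  · rw [if_neg hli]
    by_cases hlj : l = j
    · subst hlj; simp [hj, hrr.symm]
    · rw [if_neg hlj]

/-- Earlier singles are unchanged by a new round. [cite: AmbainisIraidsSmotrovs2013, §4] -/
theorem singles_addTwo_of_ne {r r' : Fin k} (hrr : r' ≠ r) {i j : Fin (2 * k + 1)} {bi : Bool}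
    (hi : h i = none) (hj : h j = none) : singles (addTwo h r i bi j) r' = singles h r' := by
  ext l
  simp only [mem_singles, addTwo]
  by_cases hli : l = i
  · subst hli; simp [hi, hrr.symm]
  · rw [if_neg hli]
    by_cases hlj : l = j
    · subst hlj; simp [hj, hrr.symm]
    · rw [if_neg hlj]

/-- A round on two distinct free indices of a valid `t`-history gives a valid `(t+1)`-history.
[cite: AmbainisIraidsSmotrovs2013, §4] -/
theorem valid_addTwo (hv : Valid t h) {r : Fin k} (hr : r.val = t) {i j : Fin (2 * k + 1)} (bi : Bool)
    (hi : i ∈ free h) (hj : j ∈ free h) (hij : i ≠ j) : Valid (t + 1) (addTwo h r i bi j) := by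
  rw [mem_free] at hi hj
  refine ⟨fun l r' b hl => ?_, fun r' hr' => ?_⟩
  · simp only [addTwo] at hl
    split_ifs at hl with h1 h2
    · cases hl; omega
    · cases hl; omega
    · have := hv.1 l r' b hl; omega
  · by_cases hrr : r' = r
    · subst hrr
      rw [labelSet_addTwo_self hv (by omega), singles_addTwo_self hv (by omega), Finset.card_pair hij]
      refine ⟨rfl, ?_⟩
      cases bi <;> simp
    · rw [labelSet_addTwo_of_ne hrr hi hj, singles_addTwo_of_ne hrr hi hj]
      exact hv.2 r' (by have : r'.val ≠ r.val := fun hh => hrr (Fin.ext hh); omega)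

/-- Erasing the round just added recovers the history. [cite: AmbainisIraidsSmotrovs2013, §4] -/
theorem eraseRound_addTwo (hv : Valid t h) {r : Fin k} (hr : t ≤ r.val) {i j : Fin (2 * k + 1)} (bi : Bool)
    (hi : h i = none) (hj : h j = none) : eraseRound (addTwo h r i bi j) r = h := by
  funext l
  simp only [eraseRound, addTwo]
  by_cases hli : l = i
  · subst hli; simp [hi]
  · rw [if_neg hli]
    by_cases hlj : l = j
    · subst hlj; simp [hj]
    · rw [if_neg hlj, if_neg (map_fst_ne_of_valid hv hr l)]

/-- Label classes survive erasing a different round. [cite: AmbainisIraidsSmotrovs2013, §4] -/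
theorem labelSet_eraseRound_of_ne {r r' : Fin k} (hrr : r' ≠ r) : labelSet (eraseRound h r) r' = labelSet h r' := by
  ext l
  simp only [mem_labelSet, eraseRound]
  split_ifs with hc
  · obtain ⟨b, hb⟩ := map_fst_eq_some_iff.1 hc
    rw [hb]; simp [Ne.symm hrr]
  · rfl

/-- Singles survive erasing a different round. [cite: AmbainisIraidsSmotrovs2013, §4] -/
theorem singles_eraseRound_of_ne {r r' : Fin k} (hrr : r' ≠ r) : singles (eraseRound h r) r' = singles h r' := by
  ext l
  simp only [mem_singles, eraseRound]
  split_ifs with hc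
  · obtain ⟨b, hb⟩ := map_fst_eq_some_iff.1 hc
    rw [hb]; simp [Ne.symm hrr]
  · rfl

/-- A valid `(t+1)`-history erased at round `t` is a valid `t`-history. [cite: AmbainisIraidsSmotrovs2013, §4] -/
theorem valid_eraseRound (hv : Valid (t + 1) h) (r : Fin k) (hr : r.val = t) : Valid t (eraseRound h r) := by
  refine ⟨fun l r' b hl => ?_, fun r' hr' => ?_⟩
  · simp only [eraseRound] at hl
    split_ifs at hl with hc
    have h1 := hv.1 l r' b hl
    have h2 : r' ≠ r := fun hh => hc (by rw [hl, hh]; rfl)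
    have h3 : r'.val ≠ t := fun hh => h2 (Fin.ext (by rw [hh, hr]))
    omega
  · have hrr : r' ≠ r := fun hh => by subst hh; omega
    rw [labelSet_eraseRound_of_ne hrr, singles_eraseRound_of_ne hrr]
    exact hv.2 r' (by omega)

/-- Erasing a round frees its indices. [cite: AmbainisIraidsSmotrovs2013, §4] -/
theorem eraseRound_apply_of_mem_labelSet {r : Fin k} {l : Fin (2 * k + 1)} (hl : l ∈ labelSet h r) :
    eraseRound h r l = none := by
  obtain ⟨b, hb⟩ := mem_labelSet.1 hl
  simp [eraseRound, hb]

/-- Re-adding the erased round (with its marks) recovers the history. [cite: AmbainisIraidsSmotrovs2013, §4] -/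
theorem addTwo_eraseRound (r : Fin k) {i j : Fin (2 * k + 1)} {bi : Bool} (hl : labelSet h r = {i, j})
    (hi : h i = some (r, bi)) (hj : h j = some (r, false)) : addTwo (eraseRound h r) r i bi j = h := by
  funext l
  simp only [addTwo, eraseRound]
  by_cases hli : l = i
  · subst hli; simp [hi]
  · rw [if_neg hli]
    by_cases hlj : l = j
    · subst hlj; simp [hj]
    · rw [if_neg hlj]
      have : l ∉ labelSet h r := by rw [hl]; simp [hli, hlj]
      rw [mem_labelSet, not_exists] at this
      rw [if_neg]
      intro hc
      obtain ⟨b, hb⟩ := map_fst_eq_some_iff.1 hc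
      exact this b hb

/-- A two-element set containing `a ≠ b` is `{a, b}`. [folklore] -/
private theorem eq_pair_of_card_two {s : Finset (Fin (2 * k + 1))} (hs : s.card = 2) {a b : Fin (2 * k + 1)}
    (ha : a ∈ s) (hb : b ∈ s) (hab : a ≠ b) : s = {a, b} := by
  symm
  apply Finset.eq_of_subset_of_card_le
  · intro l hl
    rcases Finset.mem_insert.1 hl with rfl | hl
    · exact ha
    · rw [Finset.mem_singleton.1 hl]; exact hb
  · rw [hs, Finset.card_pair hab]

/-- In a valid history the second member of a round whose first member is given is unmarked when it is not
the single. [cite: AmbainisIraidsSmotrovs2013, §4] -/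
theorem eq_false_of_ne_single (hv : Valid (t + 1) h) (r : Fin k) (hr : r.val = t) {i j : Fin (2 * k + 1)}
    (hij : i ≠ j) {bi bj : Bool} (hi : h i = some (r, bi)) (hj : h j = some (r, bj)) (hbi : bi = true) :
    bj = false := by
  by_contra hbj
  rw [Bool.not_eq_false] at hbj
  subst hbi; subst hbj
  have h2 : ({i, j} : Finset (Fin (2 * k + 1))) ⊆ singles h r := by
    intro l hl
    rcases Finset.mem_insert.1 hl with rfl | hl
    · exact mem_singles.2 hi
    · rw [Finset.mem_singleton.1 hl]; exact mem_singles.2 hj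
  have := (Finset.card_le_card h2).trans (hv.2 r (by omega)).2
  rw [Finset.card_pair hij] at this
  omega

/-- A history has at most one valid level. [cite: AmbainisIraidsSmotrovs2013, §4] -/
theorem valid_level_eq (hv : Valid t h) {t' : ℕ} (hv' : Valid t' h) (ht : t ≤ k) (ht' : t' ≤ k) : t = t' := by
  have h1 := card_free_add t hv ht
  have h2 := card_free_add t' hv' ht'
  omega

/-- A valid `t`-history is not a round-`≥ t` extension. [folklore] -/
private theorem ne_addTwo_of_valid {h' : Hist k} (hv' : Valid t h') {r : Fin k} (hr : t ≤ r.val) (g : Hist k)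
    (i j : Fin (2 * k + 1)) (bi : Bool) : h' ≠ addTwo g r i bi j := fun he =>
  ne_some_of_valid hv' hr i bi (by rw [he, addTwo_apply_left])

open Classical in
/-- The valid `t`-histories, as a `Finset`. [cite: AmbainisIraidsSmotrovs2013, §4] -/
def validSet (k t : ℕ) : Finset (Hist k) := univ.filter (Valid t)

/-- Membership in the valid set. [cite: AmbainisIraidsSmotrovs2013, §4] -/
theorem mem_validSet : h ∈ validSet k t ↔ Valid t h := by
  classical
  simp only [validSet, Finset.mem_filter, Finset.mem_univ, true_and]

/-- **Re-indexing the branching**: summing over valid `t`-histories `g`, a mark `bi` and ordered pairs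
`(i, j)` of distinct free indices a quantity attached to the child `g·(i:bi, j)` is summing over valid
`(t+1)`-histories `g'` and the ordered pairs `(i, j)` of their round-`t` class with `j` unmarked.
[cite: AmbainisIraidsSmotrovs2013, §4 (the recursion of the proof of Thm. 2)] -/
theorem sum_validSet_reindex (ht : t < k) {M : Type*} [AddCommMonoid M]
    (Φ : Hist k → Bool → Fin (2 * k + 1) × Fin (2 * k + 1) → M) :
    ∑ g ∈ validSet k t, ∑ bi : Bool, ∑ p ∈ (free g).offDiag, Φ (addTwo g ⟨t, ht⟩ p.1 bi p.2) bi p =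
      ∑ g' ∈ validSet k (t + 1), ∑ p ∈ (labelSet g' ⟨t, ht⟩).offDiag,
        if g' p.2 = some (⟨t, ht⟩, false) then Φ g' (decide (g' p.1 = some (⟨t, ht⟩, true))) p else 0 := by
  set r : Fin k := ⟨t, ht⟩ with hr_def
  -- flatten both sides to sums over sigma types
  have hL : (∑ g ∈ validSet k t, ∑ bi : Bool, ∑ p ∈ (free g).offDiag, Φ (addTwo g r p.1 bi p.2) bi p) =
      ∑ x ∈ (validSet k t).sigma (fun g => (univ : Finset Bool).sigma fun _ => (free g).offDiag),
        Φ (addTwo x.1 r x.2.2.1 x.2.1 x.2.2.2) x.2.1 x.2.2 := by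
    rw [Finset.sum_sigma]
    refine Finset.sum_congr rfl fun g _ => ?_
    exact (Finset.sum_sigma _ _ (fun y : (Σ _ : Bool, Fin (2 * k + 1) × Fin (2 * k + 1)) =>
      Φ (addTwo g r y.2.1 y.1 y.2.2) y.1 y.2)).symm
  have hR : (∑ g' ∈ validSet k (t + 1), ∑ p ∈ (labelSet g' r).offDiag,
        if g' p.2 = some (r, false) then Φ g' (decide (g' p.1 = some (r, true))) p else 0) =
      ∑ y ∈ (validSet k (t + 1)).sigma (fun g' => (labelSet g' r).offDiag.filter
        fun p => g' p.2 = some (r, false)), Φ y.1 (decide (y.1 y.2.1 = some (r, true))) y.2 := by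
    rw [Finset.sum_sigma]
    refine Finset.sum_congr rfl fun g' _ => ?_
    rw [Finset.sum_filter]
  rw [hL, hR]
  refine Finset.sum_bij' (fun x _ => ⟨addTwo x.1 r x.2.2.1 x.2.1 x.2.2.2, x.2.2⟩)
    (fun y _ => ⟨eraseRound y.1 r, ⟨decide (y.1 y.2.1 = some (r, true)), y.2⟩⟩) ?_ ?_ ?_ ?_ ?_
  · rintro ⟨g, bi, p⟩ hx
    simp only [Finset.mem_sigma, mem_validSet, Finset.mem_univ, true_and, Finset.mem_offDiag] at hx
    obtain ⟨hv, hp1, hp2, hne⟩ := hx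
    simp only [Finset.mem_sigma, mem_validSet, Finset.mem_filter, Finset.mem_offDiag, mem_labelSet]
    exact ⟨valid_addTwo hv rfl bi hp1 hp2 hne, ⟨⟨bi, addTwo_apply_left _ _ _ _ _⟩,
      ⟨false, addTwo_apply_right _ _ bi hne⟩, hne⟩, addTwo_apply_right _ _ bi hne⟩
  · rintro ⟨g', p⟩ hy
    simp only [Finset.mem_sigma, mem_validSet, Finset.mem_filter] at hy
    obtain ⟨hv', hp, hp2⟩ := hy
    have hp' := Finset.mem_offDiag.1 hp
    simp only [Finset.mem_sigma, mem_validSet, Finset.mem_univ, true_and, Finset.mem_offDiag, mem_free]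
    exact ⟨valid_eraseRound hv' r rfl, eraseRound_apply_of_mem_labelSet hp'.1,
      eraseRound_apply_of_mem_labelSet hp'.2.1, hp'.2.2⟩
  · rintro ⟨g, bi, p⟩ hx
    simp only [Finset.mem_sigma, mem_validSet, Finset.mem_univ, true_and, Finset.mem_offDiag, mem_free] at hx
    obtain ⟨hv, hp1, hp2, hne⟩ := hx
    have h1 : eraseRound (addTwo g r p.1 bi p.2) r = g := eraseRound_addTwo hv (r := r) le_rfl bi hp1 hp2
    have h2 : decide (addTwo g r p.1 bi p.2 p.1 = some (r, true)) = bi := by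
      rw [addTwo_apply_left]; cases bi <;> simp
    simp only [h1, h2]
  · rintro ⟨g', p⟩ hy
    simp only [Finset.mem_sigma, mem_validSet, Finset.mem_filter] at hy
    obtain ⟨hv', hp, hp2⟩ := hy
    have hp' := Finset.mem_offDiag.1 hp
    obtain ⟨b1, hb1⟩ := mem_labelSet.1 hp'.1
    have hl : labelSet g' r = {p.1, p.2} :=
      eq_pair_of_card_two (hv'.2 r (show r.val < t + 1 from Nat.lt_succ_self t)).1 hp'.1 hp'.2.1 hp'.2.2
    have hd : decide (g' p.1 = some (r, true)) = b1 := by rw [hb1]; cases b1 <;> simp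
    simp only [hd, addTwo_eraseRound r hl hb1 hp2]
  · rintro ⟨g, bi, p⟩ _
    have h2 : decide (addTwo g r p.1 bi p.2 p.1 = some (r, true)) = bi := by
      rw [addTwo_apply_left]; cases bi <;> simp
    simp only [h2]

/-! ### The round pair with its marks -/

/-- The round-`t` class of a valid `(t+1)`-history: `{a, b}` with `b` unmarked and `a` possibly the single.
[cite: AmbainisIraidsSmotrovs2013, §4] -/
theorem exists_round_pair (hv : Valid (t + 1) h) (r : Fin k) (hr : r.val = t) :
    ∃ a b : Fin (2 * k + 1), a ≠ b ∧ labelSet h r = {a, b} ∧ h b = some (r, false) ∧ ∃ ba, h a = some (r, ba) := by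
  obtain ⟨hcard, hsing⟩ := hv.2 r (by omega)
  obtain ⟨a, b, hab, hl⟩ := Finset.card_eq_two.1 hcard
  have ha : a ∈ labelSet h r := by rw [hl]; simp
  have hb : b ∈ labelSet h r := by rw [hl]; simp
  obtain ⟨ba, hba⟩ := mem_labelSet.1 ha
  obtain ⟨bb, hbb⟩ := mem_labelSet.1 hb
  cases bb with
  | false => exact ⟨a, b, hab, hl, hbb, ba, hba⟩
  | true =>
    have : ba = false := eq_false_of_ne_single hv r hr (Ne.symm hab) hbb hba rfl
    subst this
    exact ⟨b, a, Ne.symm hab, by rw [hl, Finset.pair_comm], hba, true, hbb⟩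

/-! ### Signs, weights and amplitudes -/

/-- `x̂_i = (−1)^{x_i}`. [cite: AmbainisIraidsSmotrovs2013, §4] -/
def xhat (x : Fin (2 * k + 1) → Bool) (i : Fin (2 * k + 1)) : ℂ := if x i = true then -1 else 1

/-- The real orientation sign of `|{i,j}⟩` seen from `i` (`+` for `j > i`, `−` for `j < i`).
[cite: AmbainisIraidsSmotrovs2013, §4 (the `U_2` formula)] -/
def pairSignR (i j : Fin (2 * k + 1)) : ℝ := if i < j then 1 else -1

/-- The complex orientation sign. [cite: AmbainisIraidsSmotrovs2013, §4] -/
def pairSign (i j : Fin (2 * k + 1)) : ℂ := (pairSignR i j : ℂ)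

/-- The orientation sign is `±1`. [cite: AmbainisIraidsSmotrovs2013, §4] -/
theorem pairSignR_mul_self (i j : Fin (2 * k + 1)) : pairSignR i j * pairSignR i j = 1 := by
  unfold pairSignR; split_ifs <;> norm_num

/-- The orientation sign is antisymmetric. [cite: AmbainisIraidsSmotrovs2013, §4] -/
theorem pairSignR_antisymm {i j : Fin (2 * k + 1)} (hij : i ≠ j) : pairSignR j i = -pairSignR i j := by
  unfold pairSignR
  rcases lt_trichotomy i j with h | h | h
  · rw [if_pos h, if_neg (not_lt.2 h.le)]
  · exact absurd h hij
  · rw [if_neg (not_lt.2 h.le), if_pos h, neg_neg]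

/-- The pair weight `√(2m−1)/(2m)` of a call on `2m+1` variables. [cite: AmbainisIraidsSmotrovs2013, §4 (`U_2`)] -/
def aP (m : ℕ) : ℝ := √(2 * (m : ℝ) - 1) / (2 * m)

/-- The single weight `1/(2m) · 1/√(2m)` (the printed `1/(2m)` times the uniform coherent choice of the
"other arbitrary input value" among the `2m` remaining). [cite: AmbainisIraidsSmotrovs2013, §4 (`U_2` and
"removing `x_i` and one other arbitrary input value")] -/
def aS (m : ℕ) : ℝ := 1 / (2 * m * √(2 * (m : ℝ)))

/-- The query-state normalisation `1/√(2m+1)`. [cite: AmbainisIraidsSmotrovs2013, §4 (`U_1`)] -/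
def cN (m : ℕ) : ℝ := 1 / √(2 * (m : ℝ) + 1)

/-- `aP² = (2m−1)/(4m²)`. [cite: AmbainisIraidsSmotrovs2013, §4 (proof of Thm. 2)] -/
theorem aP_sq {m : ℕ} (hm : 1 ≤ m) : aP m ^ 2 = (2 * (m : ℝ) - 1) / (4 * m ^ 2) := by
  have h1 : (0 : ℝ) ≤ 2 * m - 1 := by
    have : (1 : ℝ) ≤ m := by exact_mod_cast hm
    linarith
  rw [aP, div_pow, Real.sq_sqrt h1]
  ring

/-- `aS² = 1/(8m³) = (1/(2m))² · (1/(2m))`. [cite: AmbainisIraidsSmotrovs2013, §4 (proof of Thm. 2)] -/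
theorem aS_sq {m : ℕ} (hm : 1 ≤ m) : aS m ^ 2 = 1 / (8 * (m : ℝ) ^ 3) := by
  have h1 : (0 : ℝ) ≤ 2 * m := by positivity
  rw [aS, div_pow, mul_pow, Real.sq_sqrt h1]
  ring

/-- The pair weight is non-zero (`m ≥ 1`). [cite: AmbainisIraidsSmotrovs2013, §4 (proof of Thm. 2)] -/
theorem aP_ne_zero {m : ℕ} (hm : 1 ≤ m) : aP m ≠ 0 := by
  have : (1 : ℝ) ≤ m := by exact_mod_cast hm
  unfold aP
  exact div_ne_zero (Real.sqrt_ne_zero'.2 (by linarith)) (by positivity)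

/-- The single weight is non-zero (`m ≥ 1`). [cite: AmbainisIraidsSmotrovs2013, §4 (proof of Thm. 2)] -/
theorem aS_ne_zero {m : ℕ} (hm : 1 ≤ m) : aS m ≠ 0 := by
  have : (1 : ℝ) ≤ m := by exact_mod_cast hm
  unfold aS
  exact div_ne_zero one_ne_zero (mul_ne_zero (by positivity) (Real.sqrt_ne_zero'.2 (by linarith)))

/-- The query-state normalisation is non-zero. [cite: AmbainisIraidsSmotrovs2013, §4 (proof of Thm. 2)] -/
theorem cN_ne_zero (m : ℕ) : cN m ≠ 0 := by
  unfold cN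
  exact div_ne_zero one_ne_zero (Real.sqrt_ne_zero'.2 (by positivity))

/-- **The amplitude a parent `g` sends to a child along the ordered pair `q = (i, j)`**: the single term
`aS · Σ_{l ≠ i free} x̂_l` (outcome `|i⟩`, partner `j`; `bi = true`) or the pair term `aP · x̂_i · sign(i,j)`
(outcome `|i,j⟩`; `bi = false`). [cite: AmbainisIraidsSmotrovs2013, §4 ("The resulting state is …")] -/
def childAmp (x : Fin (2 * k + 1) → Bool) (g : Hist k) (r : Fin k) (bi : Bool)
    (q : Fin (2 * k + 1) × Fin (2 * k + 1)) : ℂ :=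
  if bi = true then (aS (k - r.val) : ℂ) * ∑ l ∈ (free g).erase q.1, xhat x l
  else (aP (k - r.val) : ℂ) * (xhat x q.1 * pairSign q.1 q.2)

/-- The factor of round `r` of a child history: the sum of `childAmp` of its parent over the ordered pairs
`(i, j)` of the round-`r` class with `j` unmarked (one term for a single outcome, two for a pair outcome).
[cite: AmbainisIraidsSmotrovs2013, §4 ("The resulting state is …")] -/
def roundAmp (x : Fin (2 * k + 1) → Bool) (h : Hist k) (r : Fin k) : ℂ :=
  ∑ p ∈ (labelSet h r).offDiag, if h p.2 = some (r, false) then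
    childAmp x (eraseRound h r) r (decide (h p.1 = some (r, true))) p else 0

/-- **The amplitude of a history** after `t` rounds. [cite: AmbainisIraidsSmotrovs2013, §4] -/
def beta (x : Fin (2 * k + 1) → Bool) : ℕ → Hist k → ℂ
  | 0, _ => 1
  | t + 1, h => if ht : t < k then
      beta x t (eraseRound h ⟨t, ht⟩) * (cN (k - t) : ℂ) * roundAmp x h ⟨t, ht⟩ else 0

/-- The factor of a pair-outcome round: `aP · sign(a,b) · (x̂_a − x̂_b)`. [cite: AmbainisIraidsSmotrovs2013, §4] -/
theorem roundAmp_pair {x : Fin (2 * k + 1) → Bool} {r : Fin k} {a b : Fin (2 * k + 1)} (hab : a ≠ b)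
    (hl : labelSet h r = {a, b}) (ha : h a = some (r, false)) (hb : h b = some (r, false)) :
    roundAmp x h r = (aP (k - r.val) : ℂ) * (pairSign a b * (xhat x a - xhat x b)) := by
  unfold roundAmp
  rw [sum_offDiag_eq_sum_erase, hl, Finset.sum_pair hab, Finset.erase_insert (by simp [hab]),
    Finset.sum_singleton, Finset.pair_comm, Finset.erase_insert (by simp [Ne.symm hab]),
    Finset.sum_singleton]
  simp [ha, hb, childAmp, pairSign, pairSignR_antisymm hab]
  ring

/-- The factor of a single-outcome round: `aS · Σ_{l ≠ a remaining} x̂_l`. [cite: AmbainisIraidsSmotrovs2013, §4] -/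
theorem roundAmp_single {x : Fin (2 * k + 1) → Bool} {r : Fin k} {a b : Fin (2 * k + 1)} (hab : a ≠ b)
    (hl : labelSet h r = {a, b}) (ha : h a = some (r, true)) (hb : h b = some (r, false)) :
    roundAmp x h r = (aS (k - r.val) : ℂ) * ∑ l ∈ (free (eraseRound h r)).erase a, xhat x l := by
  unfold roundAmp
  rw [sum_offDiag_eq_sum_erase, hl, Finset.sum_pair hab, Finset.erase_insert (by simp [hab]),
    Finset.sum_singleton, Finset.pair_comm, Finset.erase_insert (by simp [Ne.symm hab]),
    Finset.sum_singleton]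
  simp [ha, hb, childAmp]

/-! ### Counting: the majority is preserved along surviving histories -/

/-- `±1` per bit (`+1` for a one). [cite: AmbainisIraidsSmotrovs2013, §4] -/
def sgnZ (x : Fin (2 * k + 1) → Bool) (l : Fin (2 * k + 1)) : ℤ := if x l = true then 1 else -1

/-- `#ones − #zeros` on a set of indices. [cite: AmbainisIraidsSmotrovs2013, §4 ("the number of ones is
greater than the number of zeroes by at least 2")] -/
def diff (x : Fin (2 * k + 1) → Bool) (s : Finset (Fin (2 * k + 1))) : ℤ := ∑ l ∈ s, sgnZ x l

/-- `x̂_l = −(±1 of the bit)`. [cite: AmbainisIraidsSmotrovs2013, §4 (proof of Thm. 2)] -/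
theorem xhat_eq_neg_cast (x : Fin (2 * k + 1) → Bool) (l : Fin (2 * k + 1)) : xhat x l = -((sgnZ x l : ℤ) : ℂ) := by
  unfold xhat sgnZ; split_ifs <;> simp

/-- `Σ x̂ = −(#ones − #zeros)`. [cite: AmbainisIraidsSmotrovs2013, §4 (proof of Thm. 2)] -/
theorem sum_xhat_eq (x : Fin (2 * k + 1) → Bool) (s : Finset (Fin (2 * k + 1))) :
    ∑ l ∈ s, xhat x l = -((diff x s : ℤ) : ℂ) := by
  simp only [xhat_eq_neg_cast, Finset.sum_neg_distrib, diff, Int.cast_sum]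

/-- The printed "polynomial `Σ x̂_j` not being zero" as `#ones ≠ #zeros`. [cite: AmbainisIraidsSmotrovs2013, §4 (proof of Thm. 2)] -/
theorem sum_xhat_ne_zero_iff (x : Fin (2 * k + 1) → Bool) (s : Finset (Fin (2 * k + 1))) :
    ∑ l ∈ s, xhat x l ≠ 0 ↔ diff x s ≠ 0 := by
  rw [sum_xhat_eq, neg_ne_zero, Int.cast_ne_zero]

/-- `#ones − #zeros = 2·#ones − #s`. [cite: AmbainisIraidsSmotrovs2013, §4] -/
theorem diff_eq (x : Fin (2 * k + 1) → Bool) (s : Finset (Fin (2 * k + 1))) :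
    diff x s = 2 * ((s.filter fun l => x l = true).card : ℤ) - s.card := by
  unfold diff sgnZ
  rw [Finset.card_filter, Nat.cast_sum, Finset.mul_sum, Finset.card_eq_sum_ones s, Nat.cast_sum,
    ← Finset.sum_sub_distrib]
  refine Finset.sum_congr rfl fun l _ => ?_
  split_ifs <;> simp

/-- Adding one index adds its sign. [cite: AmbainisIraidsSmotrovs2013, §4 (proof of Thm. 2)] -/
theorem diff_insert {x : Fin (2 * k + 1) → Bool} {s : Finset (Fin (2 * k + 1))} {a : Fin (2 * k + 1)}
    (ha : a ∉ s) : diff x (insert a s) = sgnZ x a + diff x s := by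
  unfold diff; rw [Finset.sum_insert ha]

/-- Signs are `±1`. [cite: AmbainisIraidsSmotrovs2013, §4 (proof of Thm. 2)] -/
theorem sgnZ_eq_or (x : Fin (2 * k + 1) → Bool) (l : Fin (2 * k + 1)) : sgnZ x l = 1 ∨ sgnZ x l = -1 := by
  unfold sgnZ; split_ifs <;> simp

/-- The majority of `x` as the sign of `#ones − #zeros`. [cite: AmbainisIraidsSmotrovs2013, §4 (Def. 2)] -/
theorem maj_iff_diff_pos (x : Fin (2 * k + 1) → Bool) : k + 1 ≤ Grover.hw x ↔ 0 < diff x univ := by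
  rw [diff_eq, Finset.card_univ, Fintype.card_fin]
  change k + 1 ≤ (univ.filter fun l => x l = true).card ↔ _
  push_cast
  omega

/-- The free set of the erased history is the free set plus the round pair. [cite: AmbainisIraidsSmotrovs2013, §4] -/
theorem free_eraseRound_eq {r : Fin k} {a b : Fin (2 * k + 1)} (hl : labelSet h r = {a, b}) :
    free (eraseRound h r) = insert a (insert b (free h)) := by
  ext l
  simp only [mem_free, eraseRound, Finset.mem_insert]
  have hm : (h l).map Prod.fst = some r ↔ l = a ∨ l = b := by
    have := (mem_labelSet (h := h) (r := r) (i := l))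
    rw [hl, Finset.mem_insert, Finset.mem_singleton] at this
    rw [map_fst_eq_some_iff, ← this]
  by_cases hc : (h l).map Prod.fst = some r
  · rw [if_pos hc]
    simp only [true_iff]
    rcases hm.1 hc with h1 | h1
    · exact Or.inl h1
    · exact Or.inr (Or.inl h1)
  · rw [if_neg hc]
    have := mt hm.2 hc
    push Not at this
    simp [this.1, this.2]

/-- **One round preserves the majority on a surviving branch** (the printed case analysis: pair outcome ⇒
`x_i ≠ x_j`; single outcome `|i⟩` ⇒ either `x_i` is in the majority and then the others' ones outnumber
their zeroes by at least `2`, or `x_i` is in the minority). [cite: AmbainisIraidsSmotrovs2013, §4 (proof of Thm. 2)] -/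
theorem diff_pos_iff_of_roundAmp_ne_zero {x : Fin (2 * k + 1) → Bool} (hv : Valid (t + 1) h) (r : Fin k)
    (hr : r.val = t) (hne : roundAmp x h r ≠ 0) :
    (0 < diff x (free h) ↔ 0 < diff x (free (eraseRound h r))) := by
  obtain ⟨a, b, hab, hl, hb, ba, ha⟩ := exists_round_pair hv r hr
  have haF : a ∉ free h := by rw [mem_free, ha]; simp
  have hbF : b ∉ free h := by rw [mem_free, hb]; simp
  have haF' : a ∉ insert b (free h) := by simp [hab, haF]
  rw [free_eraseRound_eq hl, diff_insert haF', diff_insert hbF]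
  have hcard := card_free_add (t + 1) hv (by have := r.isLt; omega)
  have hpar : ∃ c : ℤ, diff x (free h) = 2 * c + 1 := by
    rw [diff_eq]
    exact ⟨(((free h).filter fun l => x l = true).card : ℤ) - (k - t), by omega⟩
  cases ba with
  | false =>
    -- pair outcome: `x_a ≠ x_b`, the two new signs cancel
    rw [roundAmp_pair hab hl ha hb] at hne
    have hx : x a ≠ x b := by
      intro hx
      apply hne
      simp [xhat, hx]
    have : sgnZ x a + sgnZ x b = 0 := by
      unfold sgnZ
      cases hxa : x a <;> cases hxb : x b <;> simp_all
    constructor <;> intro hp <;> linarith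
  | true =>
    -- single outcome `|a⟩`: `Σ_{l ≠ a} x̂_l ≠ 0` on the even set `free h ∪ {b}`, so `|D| ≥ 2`
    rw [roundAmp_single hab hl ha hb, free_eraseRound_eq hl, Finset.erase_insert haF'] at hne
    have hD : sgnZ x b + diff x (free h) ≠ 0 := by
      rw [← diff_insert hbF, ← sum_xhat_ne_zero_iff]
      intro h0; apply hne; rw [h0, mul_zero]
    obtain ⟨c, hc⟩ := hpar
    rcases sgnZ_eq_or x a with h1 | h1 <;> rcases sgnZ_eq_or x b with h3 | h3 <;>
      rw [h1] <;> rw [h3] at hD ⊢ <;> constructor <;> intro hp <;> omega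

/-- **Surviving histories carry the majority**: on a valid `t`-history with non-zero amplitude, the free
variables have the same majority as the input. [cite: AmbainisIraidsSmotrovs2013, §4 (proof of Thm. 2:
"`MAJ_{2m+1}(x) = MAJ_{2m−1}(x ∖ {x_i, x_j})`" in every branch)] -/
theorem diff_pos_iff_of_beta_ne_zero {x : Fin (2 * k + 1) → Bool} :
    ∀ (t : ℕ) (h : Hist k), Valid t h → beta x t h ≠ 0 → (0 < diff x (free h) ↔ 0 < diff x univ)
  | 0, h, hv, _ => by
    have : free h = univ := by
      ext l
      simp only [mem_free, Finset.mem_univ, iff_true]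
      cases hl : h l with
      | none => rfl
      | some p => obtain ⟨r, b⟩ := p; exact absurd (hv.1 l r b hl) (Nat.not_lt_zero _)
    rw [this]
  | t + 1, h, hv, hb => by
    simp only [beta] at hb
    split_ifs at hb with ht
    · have hb1 : beta x t (eraseRound h ⟨t, ht⟩) ≠ 0 := by
        intro h0; apply hb; rw [h0]; simp
      have hb2 : roundAmp x h ⟨t, ht⟩ ≠ 0 := by
        intro h0; apply hb; rw [h0]; simp
      rw [diff_pos_iff_of_roundAmp_ne_zero hv ⟨t, ht⟩ rfl hb2]
      exact diff_pos_iff_of_beta_ne_zero t _ (valid_eraseRound hv ⟨t, ht⟩ rfl) hb1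
    · exact absurd hb (by simp)

/-- **At the end the last free variable is the majority value**: on a valid full history with non-zero
amplitude, `x_l = MAJ(x)` for the (unique) free `l`. [cite: AmbainisIraidsSmotrovs2013, §4 (proof of Thm. 2,
base case "the function returns the value of the single variable")] -/
theorem eq_maj_of_beta_ne_zero {x : Fin (2 * k + 1) → Bool} (hv : Valid k h) (hb : beta x k h ≠ 0)
    {l : Fin (2 * k + 1)} (hl : l ∈ free h) : x l = true ↔ k + 1 ≤ Grover.hw x := by
  have h1 : (free h).card = 1 := by have := card_free_add k hv le_rfl; omega
  obtain ⟨l', hl'⟩ := Finset.card_eq_one.1 h1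
  rw [hl', Finset.mem_singleton] at hl
  subst hl
  rw [maj_iff_diff_pos, ← diff_pos_iff_of_beta_ne_zero k h hv hb, hl']
  unfold diff sgnZ
  rw [Finset.sum_singleton]
  cases x l <;> simp

/-- A valid full history has exactly one free index. [cite: AmbainisIraidsSmotrovs2013, §4] -/
theorem card_free_eq_one (hv : Valid k h) : (free h).card = 1 := by
  have := card_free_add k hv le_rfl; omega

/-- Valid `t`-histories with `t ≤ k` have `2(k − t) + 1 ≥ 1` free indices. [cite: AmbainisIraidsSmotrovs2013, §4] -/
theorem card_free_eq (hv : Valid t h) (ht : t ≤ k) : (free h).card = 2 * (k - t) + 1 := by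
  have := card_free_add t hv ht; omega

/-- In particular the free set is never empty. [cite: AmbainisIraidsSmotrovs2013, §4] -/
theorem free_nonempty (hv : Valid t h) (ht : t ≤ k) : (free h).Nonempty := by
  rw [← Finset.card_pos, card_free_eq hv ht]; omega

/-! ### The state space and the slice states -/

/-- The workspace is the marked history (deferred measurements). [cite: AmbainisIraidsSmotrovs2013, §4] -/
abbrev WS (k : ℕ) := Hist k

/-- The computational basis `Fin (2k+1) × Bool × WS k`. [cite: BealsEtAl2001, §2] -/
abbrev S (k : ℕ) := Fin (2 * k + 1) × Bool × WS k

/-- The normalisation `1/√(#free g)`. [cite: AmbainisIraidsSmotrovs2013, §4] -/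
def cw (g : Hist k) : ℝ := 1 / √((free g).card : ℝ)

/-- `cw(g)² · #free g = 1`. [cite: AmbainisIraidsSmotrovs2013, §4] -/
theorem cw_sq_mul_card {g : Hist k} (hg : (free g).Nonempty) : cw g ^ 2 * (free g).card = 1 := by
  have hc : (0 : ℝ) < (free g).card := by exact_mod_cast hg.card_pos
  rw [cw, div_pow, one_pow, Real.sq_sqrt hc.le]
  field_simp

/-- The amplitude profile of a call's starting state on history `g`: uniform over the free indices.
[cite: AmbainisIraidsSmotrovs2013, §4 (`U_1|0⟩ → Σ (1/√(2m+1)) |i⟩`)] -/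
def campl (g : Hist k) (l : Fin (2 * k + 1)) : ℝ := if g l = none then cw g else 0

/-- The profile is a unit vector. [cite: AmbainisIraidsSmotrovs2013, §4] -/
theorem sum_campl_sq {g : Hist k} (hg : (free g).Nonempty) : ∑ l, campl g l ^ 2 = 1 := by
  simp only [campl, ite_pow, zero_pow two_ne_zero]
  rw [← Finset.sum_filter]
  change ∑ _l ∈ free g, cw g ^ 2 = 1
  rw [Finset.sum_const, nsmul_eq_mul, mul_comm]
  exact cw_sq_mul_card hg

/-- Slices: a sum over the basis of a quantity living on one `(target, workspace)` slice. [folklore] -/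
private theorem sum_slice {M : Type*} [AddCommMonoid M] (b : Bool) (ws : WS k) (G : Fin (2 * k + 1) → M) :
    ∑ s : S k, (if s.2.1 = b ∧ s.2.2 = ws then G s.1 else 0) = ∑ l, G l := by
  rw [Fintype.sum_prod_type]
  refine Finset.sum_congr rfl fun l _ => ?_
  have hq : ∀ q : Bool × WS k, (q.1 = b ∧ q.2 = ws) ↔ q = (b, ws) := fun q => by
    constructor
    · rintro ⟨h1, h2⟩; exact Prod.ext h1 h2
    · rintro rfl; exact ⟨rfl, rfl⟩
  simp_rw [hq]
  rw [Finset.sum_ite_eq']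
  simp

/-- The (real) `b`-slice state `ψ_{g,b} = Σ_l campl g l · |l, b, g⟩`. [cite: AmbainisIraidsSmotrovs2013, §4] -/
def psiR (g : Hist k) (b : Bool) : S k → ℝ := fun s =>
  if s.2.1 = b ∧ s.2.2 = g then campl g s.1 else 0

/-- `ψ_{g,b}` vanishes off its slice. [cite: AmbainisIraidsSmotrovs2013, §4] -/
theorem psiR_of_ne {g : Hist k} {b : Bool} {s : S k} (hs : ¬ (s.2.1 = b ∧ s.2.2 = g)) :
    psiR g b s = 0 := by
  simp only [psiR, if_neg hs]

/-- **The slice states are orthonormal.** [cite: AmbainisIraidsSmotrovs2013, §4] -/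
theorem psiR_dot {g g' : Hist k} (hg : (free g).Nonempty) (b b' : Bool) :
    psiR g b ⬝ᵥ psiR g' b' = if g = g' ∧ b = b' then 1 else 0 := by
  unfold dotProduct
  by_cases hh : g = g' ∧ b = b'
  · obtain ⟨rfl, rfl⟩ := hh
    rw [if_pos ⟨rfl, rfl⟩]
    have : ∀ s : S k, psiR g b s * psiR g b s =
        if s.2.1 = b ∧ s.2.2 = g then campl g s.1 ^ 2 else 0 := fun s => by
      unfold psiR; split_ifs <;> ring
    simp_rw [this]
    exact (sum_slice b g fun l => campl g l ^ 2).trans (sum_campl_sq hg)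
  · rw [if_neg hh]
    refine Finset.sum_eq_zero fun s _ => ?_
    by_cases h1 : s.2.1 = b ∧ s.2.2 = g
    · have h2 : ¬ (s.2.1 = b' ∧ s.2.2 = g') := fun h2 => hh ⟨h1.2.symm.trans h2.2, h1.1.symm.trans h2.1⟩
      rw [psiR_of_ne h2, mul_zero]
    · rw [psiR_of_ne h1, zero_mul]

/-! ### The round family and its Gram matrix -/

/-- The pair part `Σ_{j ≠ i free} sign(i,j) ψ_{h·(i,j)}` of the image of `|i⟩`. [cite: AmbainisIraidsSmotrovs2013, §4 (`U_2`)] -/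
def pairPart (r : Fin k) (i : Fin (2 * k + 1)) (b : Bool) (h : Hist k) : S k → ℝ :=
  ∑ j ∈ (free h).erase i, pairSignR i j • psiR (addTwo h r i false j) b

/-- The single part `Σ_{j ≠ i free} Σ_{p ≠ j free} ψ_{h·(j single, p)}` of the image of `|i⟩` (the outcome `|j⟩`,
`j ≠ i`, followed by the coherent removal of one other free variable `p`). [cite: AmbainisIraidsSmotrovs2013, §4 (`U_2`)] -/
def singlePart (r : Fin k) (i : Fin (2 * k + 1)) (b : Bool) (h : Hist k) : S k → ℝ :=
  ∑ j ∈ (free h).erase i, ∑ p ∈ (free h).erase j, psiR (addTwo h r j true p) b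

/-- **The round family** (real form): `w(|i, b, h⟩) = aP · pairPart + aS · singlePart` — the printed
`U_2|i⟩ = Σ_{j>i} (√(2m−1)/2m)|i,j⟩ − Σ_{j<i} (√(2m−1)/2m)|j,i⟩ + Σ_{j≠i} (1/2m)|j⟩` followed by the deferred
measurement and the next call's preparation. [cite: AmbainisIraidsSmotrovs2013, §4 (proof of Thm. 2)] -/
def wR (r : Fin k) (d : S k) : S k → ℝ :=
  aP (k - r.val) • pairPart r d.1 d.2.1 d.2.2 + aS (k - r.val) • singlePart r d.1 d.2.1 d.2.2

/-- The round family as complex vectors. [cite: AmbainisIraidsSmotrovs2013, §4] -/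
def wvec (r : Fin k) (d : S k) : S k → ℂ := fun s => (wR r d s : ℂ)

open Classical in
/-- The live basis states before round `r`'s gate: a valid `r`-history, a free index.
[cite: AmbainisIraidsSmotrovs2013, §4] -/
def Dset (k : ℕ) (r : Fin k) : Finset (S k) :=
  univ.filter fun s => Valid r.val s.2.2 ∧ s.2.2 s.1 = none

/-- Membership in the live set of round `r`. [cite: AmbainisIraidsSmotrovs2013, §4] -/
theorem mem_Dset {r : Fin k} {s : S k} :
    s ∈ Dset k r ↔ Valid r.val s.2.2 ∧ s.2.2 s.1 = none := by
  classical
  simp only [Dset, Finset.mem_filter, Finset.mem_univ, true_and]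

section Gram

variable {r : Fin k} (hv : Valid r.val h)
include hv

/-- Children have a non-empty free set (`2m − 1 ≥ 1` variables remain). [cite: AmbainisIraidsSmotrovs2013, §4] -/
theorem free_addTwo_nonempty {i j : Fin (2 * k + 1)} (hi : h i = none) (hj : h j = none) (hij : i ≠ j)
    (bi : Bool) : (free (addTwo h r i bi j)).Nonempty := by
  rw [← Finset.card_pos, free_addTwo,
    Finset.card_erase_of_mem (Finset.mem_erase.2 ⟨Ne.symm hij, mem_free.2 hj⟩),
    Finset.card_erase_of_mem (mem_free.2 hi), card_free_eq hv (le_of_lt r.isLt)]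
  have := r.isLt; omega

/-- Two pair-children coincide iff the pairs do. [cite: AmbainisIraidsSmotrovs2013, §4] -/
theorem addTwo_false_eq_iff {i j i' j' : Fin (2 * k + 1)} (hij : i ≠ j) (hij' : i' ≠ j') :
    addTwo h r i false j = addTwo h r i' false j' ↔ ({i, j} : Finset (Fin (2 * k + 1))) = {i', j'} := by
  constructor
  · intro he
    rw [← labelSet_addTwo_self hv le_rfl i false j, he, labelSet_addTwo_self hv le_rfl]
  · intro he
    funext l
    have hl : (l = i ∨ l = j) ↔ (l = i' ∨ l = j') := by
      have h1 := congrArg (l ∈ ·) he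
      simpa using h1
    simp only [addTwo]
    by_cases h1 : l = i ∨ l = j
    · have h2 := hl.1 h1
      rw [show (if l = i then some (r, false) else if l = j then some (r, false) else h l) = some (r, false) by
        rcases h1 with rfl | rfl; simp; simp [hij.symm]]
      rcases h2 with rfl | rfl; simp; simp
    · have h2 : ¬ (l = i' ∨ l = j') := fun hh => h1 (hl.2 hh)
      push Not at h1 h2
      rw [if_neg h1.1, if_neg h1.2, if_neg h2.1, if_neg h2.2]

/-- Two single-children coincide iff single and partner do. [cite: AmbainisIraidsSmotrovs2013, §4] -/
theorem addTwo_true_eq_iff {j p j' p' : Fin (2 * k + 1)} (hjp : j ≠ p) (hp : h p = none) :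
    addTwo h r j true p = addTwo h r j' true p' ↔ j = j' ∧ p = p' := by
  constructor
  · intro he
    have h1 : j = j' := by
      have := congrFun he j
      rw [addTwo_apply_left] at this
      by_contra hne
      simp only [addTwo, if_neg hne] at this
      split_ifs at this with h2
      · simp at this
      · exact ne_some_of_valid hv le_rfl j true this.symm
    subst h1
    refine ⟨rfl, ?_⟩
    have := congrFun he p
    rw [addTwo_apply_right _ _ true hjp] at this
    by_contra hne
    simp only [addTwo, if_neg (Ne.symm hjp), if_neg hne, hp] at this
    simp at this
  · rintro ⟨rfl, rfl⟩; rfl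

/-- A pair-child is never a single-child. [cite: AmbainisIraidsSmotrovs2013, §4] -/
theorem addTwo_false_ne_true {h' : Hist k} {i j j' p' : Fin (2 * k + 1)} :
    addTwo h r i false j ≠ addTwo h' r j' true p' := by
  intro he
  have := congrFun he j'
  rw [addTwo_apply_left] at this
  simp only [addTwo] at this
  split_ifs at this with h1 h2
  · simp at this
  · simp at this
  · exact ne_some_of_valid hv le_rfl j' true this

omit hv in
/-- `⟨Σ_j σ_j ψ_j, Σ_j' σ'_j' ψ'_j'⟩` expanded. [folklore] -/
private theorem sum_smul_dot_sum_smul {ι : Type*} (A B : Finset ι) (σ τ : ι → ℝ) (u v : ι → S k → ℝ) :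
    (∑ j ∈ A, σ j • u j) ⬝ᵥ (∑ j' ∈ B, τ j' • v j') = ∑ j ∈ A, ∑ j' ∈ B, σ j * τ j' * (u j ⬝ᵥ v j') := by
  rw [sum_dotProduct]
  refine Finset.sum_congr rfl fun j _ => ?_
  rw [dotProduct_sum]
  refine Finset.sum_congr rfl fun j' _ => ?_
  rw [smul_dotProduct, dotProduct_smul, smul_eq_mul, smul_eq_mul]
  ring

omit hv in
/-- `⟨Σ_j Σ_p ψ_jp, v⟩` expanded. [folklore] -/
private theorem sum_sum_dot {ι : Type*} (A : Finset ι) (B : ι → Finset ι) (u : ι → ι → S k → ℝ) (v : S k → ℝ) :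
    (∑ j ∈ A, ∑ p ∈ B j, u j p) ⬝ᵥ v = ∑ j ∈ A, ∑ p ∈ B j, u j p ⬝ᵥ v := by
  rw [sum_dotProduct]
  exact Finset.sum_congr rfl fun j _ => sum_dotProduct _ _ _

omit hv in
/-- `⟨v, Σ_j Σ_p ψ_jp⟩` expanded. [folklore] -/
private theorem dot_sum_sum {ι : Type*} (A : Finset ι) (B : ι → Finset ι) (u : ι → ι → S k → ℝ) (v : S k → ℝ) :
    v ⬝ᵥ (∑ j ∈ A, ∑ p ∈ B j, u j p) = ∑ j ∈ A, ∑ p ∈ B j, v ⬝ᵥ u j p := by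
  rw [dotProduct_sum]
  exact Finset.sum_congr rfl fun j _ => dotProduct_sum _ _ _

omit hv in
/-- `{i, j} = {i, j'}` with `j' ≠ i` forces `j = j'`. [folklore] -/
private theorem pair_eq_pair_left {i j j' : Fin (2 * k + 1)} (hj' : j' ≠ i)
    (he : ({i, j} : Finset (Fin (2 * k + 1))) = {i, j'}) : j = j' := by
  have : j' ∈ ({i, j} : Finset (Fin (2 * k + 1))) := by rw [he]; simp
  rcases Finset.mem_insert.1 this with h1 | h1
  · exact absurd h1 hj'
  · exact (Finset.mem_singleton.1 h1).symm

omit hv in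
/-- `{i, j} = {i', j'}` with `i ≠ i'` forces `j = i'` and `j' = i`. [folklore] -/
private theorem pair_eq_pair_cross {i j i' j' : Fin (2 * k + 1)} (hii : i ≠ i')
    (he : ({i, j} : Finset (Fin (2 * k + 1))) = {i', j'}) : j = i' ∧ j' = i := by
  have h1 : i ∈ ({i', j'} : Finset (Fin (2 * k + 1))) := by rw [← he]; simp
  have h2 : i' ∈ ({i, j} : Finset (Fin (2 * k + 1))) := by rw [he]; simp
  simp only [Finset.mem_insert, Finset.mem_singleton] at h1 h2
  rcases h2 with h2 | h2
  · exact absurd h2.symm hii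
  rcases h1 with h1 | h1
  · exact absurd h1 hii
  exact ⟨h2.symm, h1.symm⟩

/-- **Gram of the pair parts**: `2m` on the diagonal, `−1` off it. [cite: AmbainisIraidsSmotrovs2013, §4] -/
theorem pairPart_dot {i i' : Fin (2 * k + 1)} (hi : h i = none) (hi' : h i' = none) (b : Bool) :
    pairPart r i b h ⬝ᵥ pairPart r i' b h =
      if i = i' then (((free h).card : ℝ) - 1) else -1 := by
  rw [pairPart, pairPart, sum_smul_dot_sum_smul]
  have hF : i ∈ free h := mem_free.2 hi
  have hF' : i' ∈ free h := mem_free.2 hi'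
  -- evaluate the inner products of the children
  have hdot : ∀ j ∈ (free h).erase i, ∀ j' ∈ (free h).erase i',
      psiR (addTwo h r i false j) b ⬝ᵥ psiR (addTwo h r i' false j') b =
        if ({i, j} : Finset (Fin (2 * k + 1))) = {i', j'} then 1 else 0 := by
    intro j hj j' hj'
    obtain ⟨hji, hjF⟩ := Finset.mem_erase.1 hj
    obtain ⟨hj'i, hj'F⟩ := Finset.mem_erase.1 hj'
    rw [psiR_dot (free_addTwo_nonempty hv hi (mem_free.1 hjF) (Ne.symm hji) false)]
    simp only [and_true, addTwo_false_eq_iff hv (Ne.symm hji) (Ne.symm hj'i)]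
  rw [Finset.sum_congr rfl fun j hj => Finset.sum_congr rfl fun j' hj' => by rw [hdot j hj j' hj']]
  by_cases hii : i = i'
  · subst hii
    rw [if_pos rfl]
    have : ∀ j ∈ (free h).erase i, ∑ j' ∈ (free h).erase i, pairSignR i j * pairSignR i j' *
        (if ({i, j} : Finset (Fin (2 * k + 1))) = {i, j'} then (1 : ℝ) else 0) = 1 := by
      intro j hj
      rw [Finset.sum_eq_single j]
      · rw [if_pos rfl, mul_one, pairSignR_mul_self]
      · intro j' hj' hne
        rw [if_neg (fun he => hne (pair_eq_pair_left (Finset.mem_erase.1 hj').1 he).symm), mul_zero]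
      · intro hj'; exact absurd hj hj'
    rw [Finset.sum_congr rfl this, Finset.sum_const, nsmul_eq_mul, mul_one, Finset.card_erase_of_mem hF,
      Nat.cast_sub (Finset.card_pos.2 ⟨i, hF⟩), Nat.cast_one]
  · rw [if_neg hii]
    have hmem : i' ∈ (free h).erase i := Finset.mem_erase.2 ⟨Ne.symm hii, hF'⟩
    rw [Finset.sum_eq_single i']
    · rw [Finset.sum_eq_single i]
      · rw [if_pos (Finset.pair_comm _ _), mul_one, pairSignR_antisymm hii]
        have := pairSignR_mul_self i i'
        linear_combination (-1 : ℝ) * this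
      · intro j' _ hj'i
        rw [if_neg (fun he => hj'i (pair_eq_pair_cross hii he).2), mul_zero]
      · intro hh; exact absurd (Finset.mem_erase.2 ⟨hii, hF⟩) hh
    · intro j _ hji'
      refine Finset.sum_eq_zero fun j' _ => ?_
      rw [if_neg (fun he => hji' (pair_eq_pair_cross hii he).1), mul_zero]
    · intro hh; exact absurd hmem hh

/-- **Gram of the single parts**: `2m·2m` on the diagonal, `2m(2m−1)` off it. [cite: AmbainisIraidsSmotrovs2013, §4] -/
theorem singlePart_dot {i : Fin (2 * k + 1)} (i' : Fin (2 * k + 1)) (hi : h i = none) (b : Bool) :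
    singlePart r i b h ⬝ᵥ singlePart r i' b h =
      (((free h).card : ℝ) - 1) * ((((free h).erase i).filter fun j => j ≠ i').card : ℝ) := by
  rw [show singlePart r i b h ⬝ᵥ singlePart r i' b h = (∑ j ∈ (free h).erase i, ∑ p ∈ (free h).erase j,
      psiR (addTwo h r j true p) b) ⬝ᵥ singlePart r i' b h from rfl, sum_sum_dot]
  have hF : i ∈ free h := mem_free.2 hi
  -- the inner double sum picks out `(j', p') = (j, p)` when `j ≠ i'`
  have hinner : ∀ j ∈ (free h).erase i, ∀ p ∈ (free h).erase j,
      psiR (addTwo h r j true p) b ⬝ᵥ singlePart r i' b h = if j ≠ i' then 1 else 0 := by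
    intro j hj p hp
    obtain ⟨hji, hjF⟩ := Finset.mem_erase.1 hj
    obtain ⟨hpj, hpF⟩ := Finset.mem_erase.1 hp
    rw [singlePart, dot_sum_sum]
    have hdot : ∀ j' ∈ (free h).erase i', ∀ p' ∈ (free h).erase j',
        psiR (addTwo h r j true p) b ⬝ᵥ psiR (addTwo h r j' true p') b = if j = j' ∧ p = p' then 1 else 0 := by
      intro j' _ p' _
      rw [psiR_dot (free_addTwo_nonempty hv (mem_free.1 hjF) (mem_free.1 hpF) (Ne.symm hpj) true)]
      simp only [and_true, addTwo_true_eq_iff hv (Ne.symm hpj) (mem_free.1 hpF)]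
    rw [Finset.sum_congr rfl fun j' hj' => Finset.sum_congr rfl fun p' hp' => hdot j' hj' p' hp']
    by_cases hji' : j ≠ i'
    · rw [if_pos hji', Finset.sum_eq_single j]
      · rw [Finset.sum_eq_single p]
        · rw [if_pos ⟨rfl, rfl⟩]
        · intro p' _ hne; rw [if_neg (fun hh => hne hh.2.symm)]
        · intro hh; exact absurd hp hh
      · intro j' _ hne
        exact Finset.sum_eq_zero fun p' _ => by rw [if_neg (fun hh => hne hh.1.symm)]
      · intro hh; exact absurd (Finset.mem_erase.2 ⟨hji', hjF⟩) hh
    · rw [if_neg hji']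
      push Not at hji'
      refine Finset.sum_eq_zero fun j' hj' => Finset.sum_eq_zero fun p' _ => ?_
      rw [if_neg]
      rintro ⟨rfl, -⟩
      exact (Finset.mem_erase.1 hj').1 hji'
  rw [Finset.sum_congr rfl fun j hj => Finset.sum_congr rfl fun p hp => hinner j hj p hp]
  rw [Finset.sum_congr rfl fun j hj => by
    rw [Finset.sum_const, Finset.card_erase_of_mem (Finset.mem_erase.1 hj).2]]
  simp_rw [smul_ite, smul_zero]
  rw [← Finset.sum_filter, Finset.sum_const, smul_smul, nsmul_eq_mul, Nat.cast_mul,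
    Nat.cast_sub (Finset.card_pos.2 ⟨i, hF⟩), Nat.cast_one, mul_one, mul_comm]

/-- The pair and single parts are orthogonal. [cite: AmbainisIraidsSmotrovs2013, §4] -/
theorem pairPart_dot_singlePart (i i' : Fin (2 * k + 1)) (b : Bool) :
    pairPart r i b h ⬝ᵥ singlePart r i' b h = 0 := by
  rw [pairPart, singlePart, sum_dotProduct]
  refine Finset.sum_eq_zero fun j _ => ?_
  rw [smul_dotProduct, dot_sum_sum, smul_eq_mul]
  refine mul_eq_zero_of_right _ (Finset.sum_eq_zero fun j' _ => Finset.sum_eq_zero fun p' _ => ?_)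
  unfold dotProduct
  refine Finset.sum_eq_zero fun s _ => ?_
  by_cases h1 : s.2.1 = b ∧ s.2.2 = addTwo h r i false j
  · rw [psiR_of_ne (g := addTwo h r j' true p'), mul_zero]
    rintro ⟨-, h2⟩
    exact addTwo_false_ne_true hv (h1.2.symm.trans h2)
  · rw [psiR_of_ne h1, zero_mul]

/-- The single and pair parts are orthogonal (symmetric form). [cite: AmbainisIraidsSmotrovs2013, §4 (proof of Thm. 2)] -/
theorem singlePart_dot_pairPart (i i' : Fin (2 * k + 1)) (b : Bool) :
    singlePart r i b h ⬝ᵥ pairPart r i' b h = 0 := by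
  rw [dotProduct_comm]; exact pairPart_dot_singlePart hv i' i b

/-- `⟨w, w'⟩ = aP²⟨A, A'⟩ + aS²⟨B, B'⟩` (same history and target slice). [cite: AmbainisIraidsSmotrovs2013, §4] -/
theorem wR_dot_same (i i' : Fin (2 * k + 1)) (b : Bool) :
    wR r (i, b, h) ⬝ᵥ wR r (i', b, h) =
      aP (k - r.val) ^ 2 * (pairPart r i b h ⬝ᵥ pairPart r i' b h) +
        aS (k - r.val) ^ 2 * (singlePart r i b h ⬝ᵥ singlePart r i' b h) := by
  simp only [wR]
  rw [add_dotProduct, dotProduct_add, dotProduct_add, smul_dotProduct, smul_dotProduct, dotProduct_smul,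
    dotProduct_smul, smul_dotProduct, smul_dotProduct, dotProduct_smul, dotProduct_smul,
    pairPart_dot_singlePart hv, singlePart_dot_pairPart hv]
  simp only [smul_eq_mul, mul_zero, add_zero, zero_add]
  ring

/-- **Unit norm**: `(2m−1)/(2m) + 1/(2m) = 1`. [cite: AmbainisIraidsSmotrovs2013, §4 (`U_2` "a unitary transformation")] -/
theorem wR_dot_self {i : Fin (2 * k + 1)} (hi : h i = none) (b : Bool) :
    wR r (i, b, h) ⬝ᵥ wR r (i, b, h) = 1 := by
  have hk := r.isLt
  have hm : 1 ≤ k - r.val := by omega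
  have hF : ((free h).card : ℝ) = 2 * ((k - r.val : ℕ) : ℝ) + 1 := by
    rw [card_free_eq hv (le_of_lt hk)]; push_cast; ring
  have hcnt : ((((free h).erase i).filter fun j => j ≠ i).card : ℝ) = 2 * ((k - r.val : ℕ) : ℝ) := by
    rw [Finset.filter_true_of_mem fun j hj => (Finset.mem_erase.1 hj).1,
      Finset.card_erase_of_mem (mem_free.2 hi), card_free_eq hv (le_of_lt hk)]
    push_cast; ring
  rw [wR_dot_same hv, pairPart_dot hv hi hi, singlePart_dot hv i hi, if_pos rfl, hcnt, hF, aP_sq hm,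
    aS_sq hm]
  have : (1 : ℝ) ≤ ((k - r.val : ℕ) : ℝ) := by exact_mod_cast hm
  field_simp
  ring

/-- **Orthogonality** for distinct free indices of one history: `−(2m−1)/(4m²) + (2m−1)/(4m²) = 0`.
[cite: AmbainisIraidsSmotrovs2013, §4] -/
theorem wR_dot_of_ne_index {i i' : Fin (2 * k + 1)} (hi : h i = none) (hi' : h i' = none) (hii : i ≠ i')
    (b : Bool) : wR r (i, b, h) ⬝ᵥ wR r (i', b, h) = 0 := by
  have hk := r.isLt
  have hm : 1 ≤ k - r.val := by omega
  have hcnt : ((((free h).erase i).filter fun j => j ≠ i').card : ℝ) = 2 * ((k - r.val : ℕ) : ℝ) - 1 := by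
    have h1 : ((free h).erase i).filter (fun j => j ≠ i') = ((free h).erase i).erase i' := by
      ext j; simp [Finset.mem_erase, and_comm, and_left_comm]
    rw [h1, Finset.card_erase_of_mem (Finset.mem_erase.2 ⟨Ne.symm hii, mem_free.2 hi'⟩),
      Finset.card_erase_of_mem (mem_free.2 hi), card_free_eq hv (le_of_lt hk)]
    rw [Nat.cast_sub (by omega)]
    push_cast
    ring
  have hF : ((free h).card : ℝ) = 2 * ((k - r.val : ℕ) : ℝ) + 1 := by
    rw [card_free_eq hv (le_of_lt hk)]; push_cast; ring
  rw [wR_dot_same hv, pairPart_dot hv hi hi', singlePart_dot hv i' hi, if_neg hii, hcnt, hF, aP_sq hm,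
    aS_sq hm]
  have : (1 : ℝ) ≤ ((k - r.val : ℕ) : ℝ) := by exact_mod_cast hm
  field_simp
  ring

end Gram

/-- `w(d)` vanishes off the slices `(d's target bit, aux = 0, a child of d's history)`. [cite: AmbainisIraidsSmotrovs2013, §4] -/
theorem wR_apply_eq_zero (r : Fin k) (d : S k) {s : S k}
    (hs : ∀ (j p : Fin (2 * k + 1)) (bj : Bool), ¬ (s.2.1 = d.2.1 ∧ s.2.2 = addTwo d.2.2 r j bj p)) :
    wR r d s = 0 := by
  simp only [wR, pairPart, singlePart, Pi.add_apply, Pi.smul_apply, Finset.sum_apply, smul_eq_mul]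
  rw [Finset.sum_eq_zero, Finset.sum_eq_zero, mul_zero, mul_zero, add_zero]
  · intro j _
    exact Finset.sum_eq_zero fun p _ => psiR_of_ne (hs j p true)
  · intro j _
    rw [psiR_of_ne (hs d.1 j false), mul_zero]

/-- Children of different valid `r`-histories, or on different target slices, are orthogonal.
[cite: AmbainisIraidsSmotrovs2013, §4] -/
theorem psiR_child_dot_eq_zero (r : Fin k) {h h' : Hist k} (hv : Valid r.val h) (hv' : Valid r.val h')
    {b b' : Bool} (hne : ¬ (b = b' ∧ h = h')) {j p j' p' : Fin (2 * k + 1)} (hj : h j = none) (hp : h p = none)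
    (hjp : j ≠ p) (hj' : h' j' = none) (hp' : h' p' = none) (bj bj' : Bool) :
    psiR (addTwo h r j bj p) b ⬝ᵥ psiR (addTwo h' r j' bj' p') b' = 0 := by
  rw [psiR_dot (free_addTwo_nonempty hv hj hp hjp bj), if_neg]
  rintro ⟨he, hb⟩
  apply hne
  refine ⟨hb, ?_⟩
  rw [← eraseRound_addTwo hv le_rfl bj hj hp, he, eraseRound_addTwo hv' le_rfl bj' hj' hp']

/-- **Gram matrix across histories / target slices**: `⟨w(d), w(d')⟩ = 0` unless same history and slice.
[cite: AmbainisIraidsSmotrovs2013, §4] -/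
theorem wR_dot_of_ne_slice (r : Fin k) {i i' : Fin (2 * k + 1)} {b b' : Bool} {h h' : Hist k}
    (hv : Valid r.val h) (hv' : Valid r.val h') (hi : h i = none) (hi' : h' i' = none)
    (hne : ¬ (b = b' ∧ h = h')) :
    wR r (i, b, h) ⬝ᵥ wR r (i', b', h') = 0 := by
  have fr : ∀ {g : Hist k} {a l : Fin (2 * k + 1)}, l ∈ (free g).erase a → g l = none ∧ l ≠ a :=
    fun hl => ⟨mem_free.1 (Finset.mem_erase.1 hl).2, (Finset.mem_erase.1 hl).1⟩
  have hAA : pairPart r i b h ⬝ᵥ pairPart r i' b' h' = 0 := by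
    rw [pairPart, pairPart, sum_smul_dot_sum_smul]
    refine Finset.sum_eq_zero fun j hj => Finset.sum_eq_zero fun j' hj' => ?_
    rw [psiR_child_dot_eq_zero r hv hv' hne hi (fr hj).1 (Ne.symm (fr hj).2) hi' (fr hj').1, mul_zero]
  have hAB : pairPart r i b h ⬝ᵥ singlePart r i' b' h' = 0 := by
    rw [pairPart, singlePart, sum_dotProduct]
    refine Finset.sum_eq_zero fun j hj => ?_
    rw [smul_dotProduct, dot_sum_sum, smul_eq_mul]
    refine mul_eq_zero_of_right _ (Finset.sum_eq_zero fun j' hj' => Finset.sum_eq_zero fun p' hp' => ?_)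
    exact psiR_child_dot_eq_zero r hv hv' hne hi (fr hj).1 (Ne.symm (fr hj).2) (fr hj').1 (fr hp').1 _ _
  have hBA : singlePart r i b h ⬝ᵥ pairPart r i' b' h' = 0 := by
    rw [singlePart, pairPart, sum_sum_dot]
    refine Finset.sum_eq_zero fun j hj => Finset.sum_eq_zero fun p hp => ?_
    rw [dotProduct_sum]
    refine Finset.sum_eq_zero fun j' hj' => ?_
    rw [dotProduct_smul, smul_eq_mul]
    exact mul_eq_zero_of_right _
      (psiR_child_dot_eq_zero r hv hv' hne (fr hj).1 (fr hp).1 (Ne.symm (fr hp).2) hi' (fr hj').1 _ _)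
  have hBB : singlePart r i b h ⬝ᵥ singlePart r i' b' h' = 0 := by
    rw [singlePart, singlePart, sum_sum_dot]
    refine Finset.sum_eq_zero fun j hj => Finset.sum_eq_zero fun p hp => ?_
    rw [dot_sum_sum]
    refine Finset.sum_eq_zero fun j' hj' => Finset.sum_eq_zero fun p' hp' => ?_
    exact psiR_child_dot_eq_zero r hv hv' hne (fr hj).1 (fr hp).1 (Ne.symm (fr hp).2) (fr hj').1 (fr hp').1 _ _
  simp only [wR]
  rw [add_dotProduct, dotProduct_add, dotProduct_add, smul_dotProduct, smul_dotProduct, dotProduct_smul,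
    dotProduct_smul, smul_dotProduct, smul_dotProduct, dotProduct_smul, dotProduct_smul, hAA, hAB, hBA, hBB]
  simp

/-- `star` fixes the (real) round vectors. [cite: AmbainisIraidsSmotrovs2013, §4] -/
@[simp] theorem star_wvec (r : Fin k) (d : S k) : star (wvec r d) = wvec r d := by
  funext s; simp [wvec]

/-- Inner products of the complex round vectors are the real ones. [cite: AmbainisIraidsSmotrovs2013, §4] -/
theorem wvec_dot (r : Fin k) (d d' : S k) : star (wvec r d) ⬝ᵥ wvec r d' = ((wR r d ⬝ᵥ wR r d' : ℝ) : ℂ) := by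
  rw [star_wvec]
  simp only [dotProduct, wvec]
  push_cast
  rfl

/-- **The round family is admissible** (orthonormal on the live states, image orthogonal to them), so
`IsoGate.invoGate` turns it into a unitary round gate — the printed "a unitary transformation `U_2`" for MAJ.
[cite: AmbainisIraidsSmotrovs2013, §4 (proof of Thm. 2)] -/
theorem wvec_isAdmissible (r : Fin k) : IsoGate.IsAdmissible (Dset k r) (wvec r) := by
  refine ⟨fun d hd d' hd' => ?_, fun d hd d' hd' => ?_⟩
  · obtain ⟨i, b, h⟩ := d
    obtain ⟨i', b', h'⟩ := d'
    rw [mem_Dset] at hd hd'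
    obtain ⟨hv, hi⟩ := hd
    obtain ⟨hv', hi'⟩ := hd'
    rw [wvec_dot]
    by_cases he : ((i, b, h) : S k) = (i', b', h')
    · rw [if_pos he, ← he, wR_dot_self hv hi]; simp
    · rw [if_neg he]
      by_cases hbh : b = b' ∧ h = h'
      · obtain ⟨rfl, rfl⟩ := hbh
        have hii : i ≠ i' := fun hii => he (by rw [hii])
        rw [wR_dot_of_ne_index hv hi hi' hii]; simp
      · rw [wR_dot_of_ne_slice r hv hv' hi hi' hbh]; simp
  · rw [mem_Dset] at hd'
    obtain ⟨hv', -⟩ := hd'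
    simp only [wvec, Complex.ofReal_eq_zero]
    refine wR_apply_eq_zero r d fun j p bj => ?_
    rintro ⟨-, hh⟩
    exact ne_addTwo_of_valid hv' le_rfl _ _ _ _ hh

/-! ### Complex forms used by the program -/

/-- The slice state as a complex vector. [cite: AmbainisIraidsSmotrovs2013, §4] -/
def psiC (g : Hist k) (b : Bool) : S k → ℂ := fun s => (psiR g b s : ℂ)

/-- **The columns of the round gate, expanded**: `w(|i,b,h⟩) = aP · Σ_{j≠i} sign(i,j) ψ_{h·(i,j),b} +
aS · Σ_{j≠i} Σ_{p≠j} ψ_{h·(j single, p),b}`. [cite: AmbainisIraidsSmotrovs2013, §4 (proof of Thm. 2)] -/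
theorem wvec_eq (r : Fin k) (i : Fin (2 * k + 1)) (b : Bool) (h : Hist k) :
    wvec r (i, b, h) = (aP (k - r.val) : ℂ) • ∑ j ∈ (free h).erase i, pairSign i j • psiC (addTwo h r i false j) b +
      (aS (k - r.val) : ℂ) • ∑ j ∈ (free h).erase i, ∑ p ∈ (free h).erase j, psiC (addTwo h r j true p) b := by
  funext s
  simp only [wvec, wR, pairPart, singlePart, Pi.smul_apply, Pi.add_apply, Finset.sum_apply, smul_eq_mul, psiC,
    pairSign]
  push_cast
  ring

/-- `star` of a slice state. [cite: AmbainisIraidsSmotrovs2013, §4] -/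
@[simp] theorem star_psiC (g : Hist k) (b : Bool) : star (psiC g b) = psiC g b := by
  funext s; simp [psiC]

/-- After a query the slice state carries the phases `x̂_l`. [cite: AmbainisIraidsSmotrovs2013, §4] -/
def psiX (x : Fin (2 * k + 1) → Bool) (g : Hist k) (b : Bool) : S k → ℂ := fun s => xhat x s.1 * psiC g b s

/-- The phased slice state in the computational basis: `Σ_{l free} x̂_l cw(g) |l, b, g⟩`. [cite: AmbainisIraidsSmotrovs2013, §4] -/
theorem psiX_eq_sum (x : Fin (2 * k + 1) → Bool) (g : Hist k) (b : Bool) :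
    psiX x g b = ∑ l ∈ free g, (xhat x l * (cw g : ℂ)) • (Pi.single (l, b, g) (1 : ℂ) : S k → ℂ) := by
  funext s
  rw [Finset.sum_apply]
  simp only [psiX, psiC, psiR, campl, Pi.smul_apply, smul_eq_mul]
  by_cases hs : s.2.1 = b ∧ s.2.2 = g
  · have hs' : s = (s.1, b, g) := Prod.ext rfl (Prod.ext hs.1 hs.2)
    rw [if_pos hs]
    by_cases hl : g s.1 = none
    · rw [if_pos hl, Finset.sum_eq_single_of_mem s.1 (mem_free.2 hl)]
      · rw [← hs', Pi.single_eq_same, mul_one]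
      · intro l _ hl'
        rw [Pi.single_eq_of_ne (fun he => hl' (congrArg Prod.fst he).symm), mul_zero]
    · rw [if_neg hl]
      push_cast
      rw [mul_zero, eq_comm]
      refine Finset.sum_eq_zero fun l hl' => ?_
      rw [Pi.single_eq_of_ne, mul_zero]
      intro he
      exact hl (by rw [he]; exact mem_free.1 hl')
  · rw [if_neg hs]
    push_cast
    rw [mul_zero, eq_comm]
    refine Finset.sum_eq_zero fun l _ => ?_
    rw [Pi.single_eq_of_ne, mul_zero]
    intro he
    exact hs (by rw [he]; exact ⟨rfl, rfl⟩)

/-- `ψ_{g,b}` lives on the slice `(b, g)`. [cite: AmbainisIraidsSmotrovs2013, §4] -/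
theorem psiC_ne_zero {g : Hist k} {b : Bool} {s : S k} (hs : psiC g b s ≠ 0) : s.2.1 = b ∧ s.2.2 = g := by
  by_contra hc
  exact hs (by rw [psiC, psiR_of_ne hc, Complex.ofReal_zero])

/-- On a full history the slice state is the basis state of the last free index. [cite: AmbainisIraidsSmotrovs2013, §4] -/
theorem psiC_apply_of_full {g : Hist k} (hv : Valid k g) (b : Bool) (s : S k) :
    psiC g b s = if s.2.1 = b ∧ s.2.2 = g ∧ g s.1 = none then 1 else 0 := by
  simp only [psiC, psiR, campl]
  have hcw : cw g = 1 := by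
    rw [cw, card_free_eq_one hv]; simp
  by_cases h1 : s.2.1 = b ∧ s.2.2 = g
  · rw [if_pos h1]
    by_cases h2 : g s.1 = none
    · rw [if_pos h2, if_pos ⟨h1.1, h1.2, h2⟩, hcw]; simp
    · rw [if_neg h2, if_neg (fun hh => h2 hh.2.2)]; simp
  · rw [if_neg h1, if_neg (fun hh => h1 ⟨hh.1, hh.2.1⟩)]; simp

/-- `cw(g) = cN(k − t)` on valid `t`-histories (`#free = 2(k−t)+1`). [cite: AmbainisIraidsSmotrovs2013, §4] -/
theorem cw_eq_cN (hv : Valid t h) (ht : t ≤ k) : cw h = cN (k - t) := by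
  rw [cw, cN, card_free_eq hv ht]
  push_cast
  rw [Nat.cast_sub ht]

/-- Swapping the two coordinates of the off-diagonal (the printed `Σ_{j>i}` / `Σ_{j<i}` bookkeeping). [cite: AmbainisIraidsSmotrovs2013, §4 (proof of Thm. 2)] -/
theorem sum_offDiag_swap {α M : Type*} [DecidableEq α] [AddCommMonoid M] (s : Finset α) (f : α → α → M) :
    ∑ p ∈ s.offDiag, f p.1 p.2 = ∑ p ∈ s.offDiag, f p.2 p.1 := by
  refine Finset.sum_equiv (Equiv.prodComm α α) (fun p => ?_) (fun p _ => rfl)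
  simp only [Finset.mem_offDiag, Equiv.prodComm_apply, Prod.fst_swap, Prod.snd_swap]
  tauto

end Literature.Computability.QuantumComplexity.Majority

end
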